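import Mathlib

/-!
# Hodge-locus census (pub-hlocus, engine A, abs-1 gen 38) — kernel anchors for the real-root / Fricke sign law (DERIVATION-GK-A §5n)

certified instances and evidence bearing on the general Hodge conjecture; no claim.

Def-free arithmetic anchors for the elementary steps of §5n (PREREG-PARTK-A.md §K-REAL):
* Fricke: `t(w₃ z)·t(z) = 3⁶` rests on `(√3)¹² = 729`; with `τ = t/27`, `τ_O·τ_𝔭₃ = 729/27² = 1`;
  `t(i/√3) = 27` (`27² = 729`) and the elliptic value `t = −27` is a root of `(t+27)(t+243)³ − j t³` at `j = 0`.
* sign of `q = e^{2πiz}` on the two real lines: `Re z = −1/2` gives `q = −e^{−2πy} < 0`, `Re z = 0` gives `q = e^{−2πy} > 0`.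
* discriminants of the ambiguous forms used for `D = −12p`, `p = 2k+1`: `(6, 6, k+2)` and `(2, 2, 3k+2)`, and of a diagonal form `(3a, 0, c)`.
* the divisor counts `n₊(m) = #{c ∣ m : c ≡ 1 (mod 3)}` for `m = 2, 11, 14, 35, 70`, and the parity facts behind `sign T₊(0) = (−1)^{n₊}`.
All proofs are `decide` / `norm_num` / `ring` / `simp` level.
-/

set_option linter.dupNamespace false

open Complex

namespace Summit.HodgeConjecture.HodgeConjecture.HodgeLocus.Census.GKRealRootAnchors

/-- Fricke constant: `(√3)^12 = 3^6 = 729`. -/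
theorem sqrt3_pow_twelve : (Real.sqrt 3) ^ 12 = 729 := by
  have h : (Real.sqrt 3) ^ 2 = 3 := Real.sq_sqrt (by norm_num)
  calc (Real.sqrt 3) ^ 12 = ((Real.sqrt 3) ^ 2) ^ 6 := by rw [← pow_mul]
    _ = 729 := by rw [h]; norm_num

/-- `τ_O · τ_𝔭₃ = t(w₃ z₃) t(z₃) / 27² = 729 / 729 = 1`, and the fixed-point value `t(i/√3) = 27`. -/
theorem fricke_bookkeeping : (729 : ℚ) / 27 ^ 2 = 1 ∧ (27 : ℚ) ^ 2 = 729 ∧ (3 : ℕ) ^ 6 = 729 := by norm_num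

/-- The elliptic point of `X₀(3)` has `j = 0` and `t = −27` (a root of `(t+27)(t+243)^3 − j·t^3` with `j = 0`); the other root is `t = −243`. -/
theorem elliptic_t_values : ((-27 : ℚ) + 27) * ((-27) + 243) ^ 3 - 0 * (-27) ^ 3 = 0 ∧
    ((-243 : ℚ) + 27) * ((-243) + 243) ^ 3 - 0 * (-243) ^ 3 = 0 := by norm_num

/-- On the line `Re z = −1/2`: `q = e^{2πi z} = −e^{−2π y}` (so `t = q⁻¹·(positive) < 0`). -/
theorem q_on_half_line (y : ℝ) :
    Complex.exp (2 * ↑Real.pi * I * (-1/2 + ↑y * I)) = -Complex.exp (-(2 * ↑Real.pi * ↑y)) := by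
  have h1 : 2 * ↑Real.pi * I * (-1/2 + ↑y * I) = -(2 * ↑Real.pi * ↑y) - ↑Real.pi * I := by
    linear_combination (2 * (↑Real.pi : ℂ) * ↑y) * I_mul_I
  rw [h1, Complex.exp_sub, Complex.exp_pi_mul_I]
  ring

/-- On the line `Re z = 0`: `q = e^{2πi(iy)} = e^{−2πy}` is a positive real (so `t > 0`). -/
theorem q_on_imaginary_axis (y : ℝ) :
    Complex.exp (2 * ↑Real.pi * I * (↑y * I)) = ↑(Real.exp (-(2 * Real.pi * y))) ∧ 0 < Real.exp (-(2 * Real.pi * y)) := by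
  refine ⟨?_, Real.exp_pos _⟩
  have h1 : 2 * ↑Real.pi * I * (↑y * I) = ((-(2 * Real.pi * y) : ℝ) : ℂ) := by
    push_cast
    linear_combination (2 * (↑Real.pi : ℂ) * ↑y) * I_mul_I
  rw [h1, Complex.ofReal_exp]

/-- Discriminants of the ambiguous forms for `D = −12p`, `p = 2k+1`: `(6,6,k+2)` (class `𝔭₂𝔭₃`, `3 ∣ 6`, hence `τ < 0`) and `(2,2,3k+2)` (class `𝔭₂`);
and of a diagonal form `(3a, 0, c)` with `ac = m`: `−12m`. -/
theorem ambiguous_form_discriminants (k a c : ℤ) :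
    (6 : ℤ) ^ 2 - 4 * 6 * (k + 2) = -12 * (2 * k + 1) ∧ (2 : ℤ) ^ 2 - 4 * 2 * (3 * k + 2) = -12 * (2 * k + 1) ∧
    (0 : ℤ) ^ 2 - 4 * (3 * a) * c = -12 * (a * c) := by
  refine ⟨by ring, by ring, by ring⟩

/-- Shape change used in Lemma 4: `f(x, x + y)` turns `(a, b, a)` into `(2a + b, 2a + b, a)`, a form of shape `(A, A, C)`. -/
theorem aba_to_AAC (a b x y : ℤ) :
    a * x ^ 2 + b * x * (x + y) + a * (x + y) ^ 2 = (2 * a + b) * x ^ 2 + (2 * a + b) * x * y + a * y ^ 2 := by ring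

/-- `n₊(m) = #{c ∣ m : c ≡ 1 (mod 3)}`: the counts for `m = 2, 11` (prime, type √3: one ⇒ sign −), `m = 14, 35` (composite, type √3: two ⇒ sign +), `m = 70` (type ζ₃: four). -/
theorem npos_counts :
    ((Nat.divisors 2).filter (fun c => c % 3 = 1)).card = 1 ∧ ((Nat.divisors 11).filter (fun c => c % 3 = 1)).card = 1 ∧
    ((Nat.divisors 14).filter (fun c => c % 3 = 1)).card = 2 ∧ ((Nat.divisors 35).filter (fun c => c % 3 = 1)).card = 2 ∧
    ((Nat.divisors 70).filter (fun c => c % 3 = 1)).card = 4 := by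
  refine ⟨by decide, by decide, by decide, by decide, by decide⟩

/-- Parity behind the sign law: `(−1)^{2^{k+1}} = 1` (composite type-√3 `m`, `ω(m) = k + 2 ≥ 2` gives `n₊ = 2^{k+1}`), while `(−1)^{2^0} = −1` (prime `m`). -/
theorem sign_parity (k : ℕ) : (-1 : ℤ) ^ (2 ^ (k + 1)) = 1 ∧ (-1 : ℤ) ^ (2 ^ 0) = -1 := by
  refine ⟨?_, by norm_num⟩
  have he : Even (2 ^ (k + 1)) := Nat.even_pow.mpr ⟨even_two, Nat.succ_ne_zero k⟩
  exact he.neg_one_pow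

/-- The residues used: primes `m ≡ 11 (mod 12)` are `≡ 2 (mod 3)` and `≡ 3 (mod 4)`; `2 ≡ 2 (mod 3)`, `2 ≡ 2 (mod 4)`; and `B's w = 2√m ≡ −√m (mod 3)` is `2 = -1` in `ZMod 3`. -/
theorem residue_facts : (11 : ℕ) % 3 = 2 ∧ (11 : ℕ) % 4 = 3 ∧ (2 : ℕ) % 3 = 2 ∧ (2 : ℕ) % 4 = 2 ∧ (2 : ZMod 3) = -1 := by
  refine ⟨by norm_num, by norm_num, by norm_num, by norm_num, by decide⟩

/-- The nine negative-sign discriminants of the first even batch are `−12·m` with `m` prime: -/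
theorem first_batch_negatives :
    [24, 132, 276, 564, 708, 852, 996, 1284, 1572].map (· / 12) = [2, 11, 23, 47, 59, 71, 83, 107, 131] ∧
    ([2, 11, 23, 47, 59, 71, 83, 107, 131].all Nat.Prime) = true := by
  refine ⟨by decide, by decide⟩

end Summit.HodgeConjecture.HodgeConjecture.HodgeLocus.Census.GKRealRootAnchors
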